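/-
Copyright (c) 2026. All rights reserved.
Released under Apache 2.0 license as described in the file LICENSE.
Authors: abc-iut cell, seat abc-iut-w5-d169 (gen 16; row «PL2-LEAF-2», optional leaf (Hχ)).
-/
import Literature.AnabelianGeometry.EtaleTheta.ZHatPrimaryIdempotents
import Literature.AnabelianGeometry.EtaleTheta.SettingModelCyclotomicCharacterInvariants
import Mathlib.NumberTheory.Multiplicity
import Mathlib.NumberTheory.Padics.PadicVal.Basic
import HarnessLib

/-!
# (Hχ‴): every `ℓ`-component of the cyclotomic character of `G_{ℚ_p}` has unbounded exponent

J. Neukirch, *Algebraic Number Theory*, Ch. II Prop. (5.7) (i) (the roots of unity of a `p`-adic field form a finite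
group — whence `H⁰(U, Ẑ(χ)) = 1` for `U ≤ G_{ℚ_p}` open, the tree's `SettingModel.eq_one_of_forall_chi_apply_eq_of_isOpen`,
abc-iut-w5-d091) [cite: NeukirchANT1999, Ch. II Prop. (5.7) (i)]; Ribes–Zalesskii, *Profinite Groups*, Thm 2.7.1 /
2.7.2 (`Ẑ = lim ℤ/n ≅ ∏_ℓ ℤ_ℓ`; the level characters `ZHatLevel.level`, `ZHatLevel.levelChar` of `CyclotomeZHatAction`,
the compatible families of `ZHatLevelDetermination`, the primary idempotents `ZHatLevel.primaryIdem ℓ = e_ℓ` of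
`ZHatPrimaryIdempotents`) [cite: RibesZalesskii2010, Thm 2.7.2]; the lifting-the-exponent lemma (Mathlib
`Int.emultiplicity_pow_sub_pow`, `Int.two_pow_sub_pow'`).  `chi p : G_{ℚ_p} → Aut(Ẑ)` is abc-iut-w5-d091's genuine
cyclotomic character on `PadicAlgCl p` (`SettingModelCyclotomicCharacter`).  All consumed BY NAME.

PROOF-ONLY file (no definition, no instance, no notation), abc-iut cell layer L6, seat abc-iut-w5-d169 (gen 16), row
PL2-LEAF-2 of abc-iut-L6-lead — optional leaf **(Hχ)** of programme P-L2, rung (L2-T): the hypothesis (Hχ‴) of the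
cell's desk text PL2-SEP-v2-NOTES (sha16 a540c16b9a5d4139, (R1)) for `U = χ(G_{ℚ_p})` — *«for every prime `ℓ` there
is `u₀ ∈ U` whose `ℓ`-component `(u₀)_ℓ ∈ ℤ_ℓ^×` has INFINITE ORDER»* — in the finite-level form that the torus-law
argument (T⇒E) consumes: **for every prime `ℓ` and every `M ≥ 1` some `σ ∈ G_{ℚ_p}` has `χ_{ℓ^k}(χ(σ)^M) ≠ 1` at
some `ℓ`-power level `ℓ^k`** (`exists_levelChar_chi_pow_ne_one`; the slot `ℓ ≠ p` flagged OPEN-IN-TREE by (R2) is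
covered, uniformly in `ℓ`).

* `ZHatLevel.levelChar_prime_pow_eq_natCast_val` — `χ_{ℓ^j}(φ) = χ_{ℓ^K}(φ) mod ℓ^j` (`j ≤ K`);
* `ZHatLevel.levelChar_prime_pow_eq_one_of_pow` — LIFTING THE EXPONENT in `Aut(Ẑ)`: `χ_{ℓ²}(φ) = 1` and `χ_{ℓ^K}(φ^M) = 1`
  for all `K` (`M ≥ 1`) force `χ_{ℓ^k}(φ) = 1` for all `k` (`v_ℓ(u^M - 1) = v_ℓ(u - 1) + v_ℓ(M)` on an integer
  representative `u` of `χ_{ℓ^K}(φ)`, `K = k + 2 + v_ℓ(M)`);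
* `ZHatLevel.apply_primaryIdem_eq_self_of_forall_levelChar_eq_one` — such a `φ` FIXES `e_ℓ` (at level `n`:
  `ℓ^{v_ℓ(n)} ∣ χ_n(φ) - 1` and `n/ℓ^{v_ℓ(n)} ∣ e_ℓ mod n`);
* ★ `SettingModel.exists_levelChar_chi_pow_ne_one` / `…_pow_apply_ne_one` / `exists_levelChar_prime_pow_chi_ne_one` — (Hχ‴):
  otherwise the OPEN subgroup `{σ | χ_{ℓ²}(σ) = 1}` (`isOpen_setOf_levelChar_chi_eq_one`) fixes `e_ℓ ≠ 1`, against
  `H⁰(U, Ẑ(χ)) = 1`.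
Classical local algebra / profinite bookkeeping about OUR `chi p`; nothing of [EtTh] is asserted; no side is taken on
[IUTchIII] Cor. 3.12; typed ≠ proved ≠ print.
-/

noncomputable section

open CategoryTheory ProfiniteGrp ProfiniteGrp.ProfiniteCompletion

namespace Literature.AnabelianGeometry.EtaleTheta

namespace ZHatLevel

/-- `ℕ∞` bookkeeping: `K ≤ e + v` and `k + v ≤ K` give `k ≤ e`. [folklore] -/
private theorem natCast_le_of_le_add {K v k : ℕ} {e : ℕ∞} (h : (K : ℕ∞) ≤ e + v) (hk : k + v ≤ K) :
    (k : ℕ∞) ≤ e := by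
  induction e using ENat.recTopCoe with
  | top => exact le_top
  | coe m =>
    have h' : K ≤ m + v := by exact_mod_cast h
    exact_mod_cast (show k ≤ m by omega)

/-- The `ℓ`-power level characters of `φ ∈ Aut(Ẑ)` are the reductions of any deeper one: for `j ≤ K`,
`χ_{ℓ^j}(φ) = χ_{ℓ^K}(φ) mod ℓ^j`. [cite: RibesZalesskii2010, Thm 2.7.1] -/
theorem levelChar_prime_pow_eq_natCast_val {ℓ : ℕ} (hℓ : 0 < ℓ)
    (φ : MulAut (completion (GrpCat.of (Multiplicative ℤ)))) {j K : ℕ} (hjK : j ≤ K) :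
    levelChar ⟨ℓ ^ j, pow_pos hℓ j⟩ φ = ((levelChar ⟨ℓ ^ K, pow_pos hℓ K⟩ φ).val : ZMod (ℓ ^ j)) := by
  haveI : NeZero (((⟨ℓ ^ K, pow_pos hℓ K⟩ : ℕ+) : ℕ)) := ⟨(pow_pos hℓ K).ne'⟩
  have hc := (LevelFamily.ofAut φ).compat ⟨ℓ ^ j, pow_pos hℓ j⟩ ⟨ℓ ^ K, pow_pos hℓ K⟩ (pow_dvd_pow ℓ hjK)
  rw [LevelFamily.ofAut_c, LevelFamily.ofAut_c, ZMod.castHom_apply, ZMod.cast_eq_val] at hc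
  exact hc.symm

/-- **Lifting the exponent**, `Aut(Ẑ)` form: if `χ_{ℓ²}(φ) = 1` and `χ_{ℓ^K}(φ^M) = 1` for ALL `K` (`M ≥ 1`), then
`χ_{ℓ^k}(φ) = 1` for all `k` — an `ℓ`-adic unit `u ≡ 1 (mod ℓ²)` with `u^M = 1` is `1`, since
`v_ℓ(u^M - 1) = v_ℓ(u - 1) + v_ℓ(M)` (Mathlib's `Int.emultiplicity_pow_sub_pow` / `Int.two_pow_sub_pow'`).
[cite: RibesZalesskii2010, Thm 2.7.1] -/
theorem levelChar_prime_pow_eq_one_of_pow {ℓ : ℕ} (hℓ : ℓ.Prime)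
    (φ : MulAut (completion (GrpCat.of (Multiplicative ℤ)))) {M : ℕ} (hM : M ≠ 0)
    (h2 : levelChar ⟨ℓ ^ 2, pow_pos hℓ.pos 2⟩ φ = 1)
    (hM1 : ∀ K : ℕ, levelChar ⟨ℓ ^ K, pow_pos hℓ.pos K⟩ (φ ^ M) = 1) (k : ℕ) :
    levelChar ⟨ℓ ^ k, pow_pos hℓ.pos k⟩ φ = 1 := by
  haveI := Fact.mk hℓ
  -- a deep level `K` and the integer representative `u` of `χ_{ℓ^K}(φ)`
  set v : ℕ := padicValNat ℓ M with hv
  set K : ℕ := k + 2 + v with hK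
  haveI : NeZero (((⟨ℓ ^ K, pow_pos hℓ.pos K⟩ : ℕ+) : ℕ)) := ⟨(pow_pos hℓ.pos K).ne'⟩
  set u : ℕ := (levelChar ⟨ℓ ^ K, pow_pos hℓ.pos K⟩ φ).val with hu
  -- `u ≡ 1 (mod ℓ²)`
  have hu2 : ((ℓ : ℤ) ^ 2) ∣ (u : ℤ) - 1 := by
    have h := levelChar_prime_pow_eq_natCast_val hℓ.pos φ (show 2 ≤ K by omega)
    rw [h2, ← hu] at h
    have h' : ((1 : ℤ) : ZMod (ℓ ^ 2)) = ((u : ℤ) : ZMod (ℓ ^ 2)) := by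
      rw [Int.cast_one, Int.cast_natCast]; exact h
    have := (ZMod.intCast_eq_intCast_iff_dvd_sub 1 (u : ℤ) (ℓ ^ 2)).1 h'
    exact_mod_cast this
  -- `u^M ≡ 1 (mod ℓ^K)`
  have huM : ((ℓ : ℤ) ^ K) ∣ (u : ℤ) ^ M - 1 := by
    have h := hM1 K
    rw [map_pow, ← ZMod.natCast_zmod_val (levelChar ⟨ℓ ^ K, pow_pos hℓ.pos K⟩ φ), ← hu, ← Nat.cast_pow] at h
    have h' : ((1 : ℤ) : ZMod (ℓ ^ K)) = (((u ^ M : ℕ) : ℤ) : ZMod (ℓ ^ K)) := by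
      rw [Int.cast_one, Int.cast_natCast]; exact h.symm
    have := (ZMod.intCast_eq_intCast_iff_dvd_sub 1 ((u ^ M : ℕ) : ℤ) (ℓ ^ K)).1 h'
    push_cast at this
    exact this
  -- `ℓ ∤ u`
  have hℓu : ¬ (ℓ : ℤ) ∣ (u : ℤ) := by
    intro h
    have h1 : (ℓ : ℤ) ∣ (u : ℤ) - 1 := (dvd_pow_self (ℓ : ℤ) two_ne_zero).trans hu2
    have h2' : (ℓ : ℤ) ∣ 1 := by
      have := dvd_sub h h1
      rwa [sub_sub_cancel] at this
    exact hℓ.one_lt.ne' (Int.natAbs_natCast ℓ ▸ Int.eq_one_of_dvd_one (Int.natCast_nonneg ℓ) h2' ▸ rfl)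
  -- lifting the exponent: `v_ℓ(u^M - 1) = v_ℓ(u - 1) + v_ℓ(M)`
  have hLTE : emultiplicity (ℓ : ℤ) ((u : ℤ) ^ M - 1) = emultiplicity (ℓ : ℤ) ((u : ℤ) - 1) + (v : ℕ∞) := by
    have hvE : (v : ℕ∞) = emultiplicity ℓ M := by rw [hv]; exact padicValNat_eq_emultiplicity hM
    rcases hℓ.eq_two_or_odd' with rfl | hodd
    · have h4 : (4 : ℤ) ∣ (u : ℤ) - 1 := by simpa using hu2
      have h := Int.two_pow_sub_pow' M h4 (by exact_mod_cast hℓu)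
      rw [one_pow, ← Nat.cast_ofNat, Int.natCast_emultiplicity] at h
      rw [h, hvE]
    · have h1 : (ℓ : ℤ) ∣ (u : ℤ) - 1 := (dvd_pow_self (ℓ : ℤ) two_ne_zero).trans hu2
      have h := Int.emultiplicity_pow_sub_pow hℓ hodd h1 hℓu M
      rw [one_pow] at h
      rw [h, hvE]
  -- hence `ℓ^k ∣ u - 1`
  have hk : (k : ℕ∞) ≤ emultiplicity (ℓ : ℤ) ((u : ℤ) - 1) :=
    natCast_le_of_le_add (hLTE ▸ le_emultiplicity_of_pow_dvd huM) (by omega)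
  have hdvd : ((ℓ : ℤ) ^ k) ∣ (u : ℤ) - 1 := pow_dvd_of_le_emultiplicity hk
  -- read back at level `ℓ^k`
  rw [levelChar_prime_pow_eq_natCast_val hℓ.pos φ (show k ≤ K by omega), ← hu]
  have h' : ((1 : ℤ) : ZMod (ℓ ^ k)) = ((u : ℤ) : ZMod (ℓ ^ k)) :=
    (ZMod.intCast_eq_intCast_iff_dvd_sub 1 (u : ℤ) (ℓ ^ k)).2 (by exact_mod_cast hdvd)
  rw [Int.cast_one, Int.cast_natCast] at h'
  exact h'.symm

/-- **An automorphism of `Ẑ` whose `ℓ`-power characters are all `1` fixes the idempotent `e_ℓ`**: at level `n`,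
`(χ_n(φ) - 1)·e_ℓ ≡ 0` because `ℓ^{v_ℓ(n)} ∣ χ_n(φ) - 1` and `n/ℓ^{v_ℓ(n)} ∣ e_ℓ`.
[cite: RibesZalesskii2010, Thm 2.7.2] -/
theorem apply_primaryIdem_eq_self_of_forall_levelChar_eq_one {ℓ : ℕ} (hℓ : ℓ.Prime)
    (φ : MulAut (completion (GrpCat.of (Multiplicative ℤ))))
    (h : ∀ k : ℕ, levelChar ⟨ℓ ^ k, pow_pos hℓ.pos k⟩ φ = 1) : φ (primaryIdem ℓ) = primaryIdem ℓ := by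
  refine ext_of_level fun n => Multiplicative.toAdd.injective ?_
  haveI : NeZero (n : ℕ) := ⟨n.ne_zero⟩
  rw [toAdd_level_aut, toAdd_level_primaryIdem]
  have hdvd : ordProj[ℓ] n ∣ (n : ℕ) := Nat.ordProj_dvd n ℓ
  have hL : ZMod.castHom hdvd (ZMod (ordProj[ℓ] n)) (levelChar n φ) = 1 := by
    have hc := (LevelFamily.ofAut φ).compat ⟨ordProj[ℓ] n, Nat.ordProj_pos n ℓ⟩ n hdvd
    rw [LevelFamily.ofAut_c, LevelFamily.ofAut_c, h] at hc
    exact hc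
  have h1 : ordProj[ℓ] n ∣ (levelChar n φ - 1).val := by
    rw [← ZMod.natCast_eq_zero_iff, ← ZMod.cast_eq_val,
      ← ZMod.castHom_apply (h := hdvd) (R := ZMod (ordProj[ℓ] n)), map_sub, map_one, hL, sub_self]
  have h2 : (n : ℕ) ∣ (levelChar n φ - 1).val * primaryIdemNat ℓ n := by
    conv_lhs => rw [← Nat.ordProj_mul_ordCompl_eq_self n ℓ]
    exact Nat.mul_dvd_mul h1 (ordCompl_dvd_primaryIdemNat ℓ n)
  have h3 : (levelChar n φ - 1) * (primaryIdemNat ℓ n : ZMod n) = 0 := by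
    rw [← ZMod.natCast_zmod_val (levelChar n φ - 1), ← Nat.cast_mul, ZMod.natCast_eq_zero_iff]
    exact h2
  rwa [sub_mul, one_mul, sub_eq_zero] at h3

end ZHatLevel

/-! ### (Hχ‴) for the cyclotomic character of `G_{ℚ_p}` -/

namespace SettingModel

open ZHatLevel
open Literature.AnabelianGeometry.SemiGraphs (GQp)

variable (p : ℕ) [Fact p.Prime]

/-- **(Hχ‴) — every `ℓ`-component of `χ(G_{ℚ_p})` has unbounded exponent.**  For every prime `ℓ` and every
`M ≥ 1` some `σ ∈ G_{ℚ_p}` has `χ(σ)^M` non-trivial at some `ℓ`-power level: `χ_{ℓ^k}(χ(σ)^M) ≠ 1`.  Proof: otherwise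
every `σ` in the OPEN subgroup `U = {σ | χ_{ℓ²}(σ) = 1}` (`isOpen_setOf_levelChar_chi_eq_one`) has all its `ℓ`-power
characters equal to `1` (lifting the exponent, `levelChar_prime_pow_eq_one_of_pow`), hence `χ(σ)` fixes the primary
idempotent `e_ℓ ∈ Ẑ` (`apply_primaryIdem_eq_self_of_forall_levelChar_eq_one`); but `Ẑ(χ)` has no invariants under an
open subgroup (`eq_one_of_forall_chi_apply_eq_of_isOpen`, Neukirch II (5.7)(i)), so `e_ℓ = 1` — absurd
(`primaryIdem_ne_one`).  This is the input (Hχ‴) of PL2-SEP-v2-NOTES (R1) for `U = χ(G_{ℚ_p})`, for EVERY prime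
`ℓ` (the slot `ℓ ≠ p` included). [cite: NeukirchANT1999, Ch. II Prop. (5.7) (i)] -/
theorem exists_levelChar_chi_pow_ne_one {ℓ : ℕ} (hℓ : ℓ.Prime) {M : ℕ} (hM : M ≠ 0) :
    ∃ (σ : GQp p) (k : ℕ), levelChar ⟨ℓ ^ k, pow_pos hℓ.pos k⟩ (chi p σ ^ M) ≠ 1 := by
  by_contra H
  push Not at H
  set L2 : ℕ+ := ⟨ℓ ^ 2, pow_pos hℓ.pos 2⟩ with hL2
  set U : Subgroup (GQp p) := ((levelChar L2).comp (chi p)).ker with hUdef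
  have hUset : (U : Set (GQp p)) = {σ : GQp p | levelChar L2 (chi p σ) = 1} := by
    ext σ
    rw [SetLike.mem_coe, hUdef, MonoidHom.mem_ker, MonoidHom.comp_apply, Set.mem_setOf_eq]
  have hU : IsOpen (U : Set (GQp p)) := by
    rw [hUset]
    exact isOpen_setOf_levelChar_chi_eq_one p L2
  have hfix : ∀ σ ∈ U, chi p σ (primaryIdem ℓ) = primaryIdem ℓ := fun σ hσ =>
    apply_primaryIdem_eq_self_of_forall_levelChar_eq_one hℓ (chi p σ)
      (levelChar_prime_pow_eq_one_of_pow hℓ (chi p σ) hM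
        (by rw [hUdef, MonoidHom.mem_ker, MonoidHom.comp_apply] at hσ; exact hσ)
        (fun K => H σ K))
  exact primaryIdem_ne_one hℓ (eq_one_of_forall_chi_apply_eq_of_isOpen p U hU hfix)

/-- **(Hχ‴), `M`-th-power form**: for every prime `ℓ` and `M ≥ 1` there is `σ` whose `M`-th power `σ^M` has a
cyclotomic character non-trivial at some `ℓ`-power level. [cite: NeukirchANT1999, Ch. II Prop. (5.7) (i)] -/
theorem exists_levelChar_chi_pow_apply_ne_one {ℓ : ℕ} (hℓ : ℓ.Prime) {M : ℕ} (hM : M ≠ 0) :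
    ∃ (σ : GQp p) (k : ℕ), levelChar ⟨ℓ ^ k, pow_pos hℓ.pos k⟩ (chi p (σ ^ M)) ≠ 1 := by
  obtain ⟨σ, k, h⟩ := exists_levelChar_chi_pow_ne_one p hℓ hM
  exact ⟨σ, k, by rw [map_pow]; exact h⟩

/-- **The `ℓ`-component of `χ` is non-trivial for EVERY prime `ℓ`** (the case `M = 1`; the tree's
`exists_levelChar_chi_ne_one` / `…_of_sq_dvd` of `SettingModelCyclotomicCharacterLevelNontrivial` cover the slot
`ℓ = p` by exhibiting roots of unity): some `σ ∈ G_{ℚ_p}` has `χ_{ℓ^k}(σ) ≠ 1` at some `ℓ`-power level.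
[cite: NeukirchANT1999, Ch. II Prop. (5.7) (i)] -/
theorem exists_levelChar_prime_pow_chi_ne_one {ℓ : ℕ} (hℓ : ℓ.Prime) :
    ∃ (σ : GQp p) (k : ℕ), levelChar ⟨ℓ ^ k, pow_pos hℓ.pos k⟩ (chi p σ) ≠ 1 := by
  obtain ⟨σ, k, h⟩ := exists_levelChar_chi_pow_ne_one p hℓ one_ne_zero
  exact ⟨σ, k, by rw [pow_one] at h; exact h⟩

end SettingModel

end Literature.AnabelianGeometry.EtaleTheta

end
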